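import Summits.AtomisticToContinuum.BoseEinsteinCondensation.Theorems.BoxCountShadowDisplacement
import HarnessLib

/-!
# BoxCountShadowExchange — continuation of BoxCountShadowDisplacement: Bose exchangeability on the count lattice (§10, part 1)

Continuation of `BoxCountShadowDisplacement` (same namespace).  For a Bose-symmetric amplitude the tagged-particle
objects of `BoxCountShadowCell` / `BoxCountShadowDisplacement` are functionals of the laws of the FULL cell counts
`N_B(X)`: `countVec_vecCons`, `countVec_comp_perm`, the exchange identity
`exchange_cellPairMass : N · ∫_{m_B ∈ D} q_{B'} = ∫ N_{B'} 1_{N_B ∈ D} Φ²` (`B' ≠ B`), `cellSlice_le_full`; and the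
tools of the ring-share bound: `tsum_indicator_fibre`, `blockWeight_sq`, `countVariance`
(`Σ_B K⁻³ E(N_B/λ − 1)²`), the designated neighbour `nb` (`nb_mem_nbrs`, `sum_nb_le`), `le_markov_add_chebyshev`.
No instances, no notation, no sorry.
-/

open MeasureTheory Filter Set
open scoped ENNReal NNReal BigOperators

namespace Summit.AtomisticToContinuum.BoseEinsteinCondensation.Theorems.BoxCountShadow

open Literature.MathematicalPhysics.QuantumManyBody.BoseGas
open Summit.AtomisticToContinuum.BoseEinsteinCondensation.Theorems.BoxLatticeFSum
open Summit.AtomisticToContinuum.BoseEinsteinCondensation.Theorems.BoxLabelAffinity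
open Summit.AtomisticToContinuum.BoseEinsteinCondensation.Theorems.BoxHorizonAffinity

variable {n : ℕ}

/-! ### §10  The ring share from the density law of large numbers: RSH_h ⟸ DL_h (Bose symmetry)

For a Bose-symmetric amplitude the tagged-particle objects of §6/§8b are functionals of the law of the FULL
cell counts `N_B(X) = #{i ≤ N : x_i ∈ Q_B}` under `|Φ|² dX`:
`N · ∫_{m_B(Y) ∈ D} q_{B'}(Y) dY = ∫ N_{B'}(X) 1_{N_B(X) ∈ D} Φ(X)² dX` for `B' ≠ B` (`exchange_cellPairMass`), and
`∫_{m_B(Y) ∈ D} P̂(Y) dY ≤ ∫ 1_{N_B(X) ∈ D} Φ² dX + ∫ q_B` (`cellSlice_le_full`).  With these, Markov and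
Chebyshev, the ring-share door RSH_h follows from the DENSITY LAW OF LARGE NUMBERS at the horizon scale
DL_h (`GroundStateHorizonDensityLLN`: `Σ_B K⁻³ E_{Φ²}(N_B/λ − 1)² ≤ s`, `λ = N/K³`), an ENERGY-CLASS statement
(convexity of `e(ρ) = 4πaρ²(1+…)` in the cell densities against the LHY-sharp upper bound, inside the sighted region
of the pinned lower bound), via the functional inequality
`pairWeightOn {(B,j) : Q_{B→nb B}(j) < θ·K⁻³P̄_B(j)} ≤ 2θ + 8·countVariance + K⁻³` (`ringShareDefect_le`). -/

/-- The count field of `x :: Y`: `N_B(x :: Y) = 1_{x ∈ Q_B} + m_B(Y)`. [folklore] -/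
theorem countVec_vecCons (ℓ : ℝ) (K : ℕ) (x : Space) (Y : Config n) (B : SubIdx K) :
    countVec ℓ K (Matrix.vecCons x Y : Config (n + 1)) B =
      (subCell ℓ B).indicator (fun _ => (1 : ℕ)) x + countVec ℓ K Y B := by
  unfold countVec
  rw [Fin.sum_univ_succ]
  simp only [Matrix.cons_val_zero, Matrix.cons_val_succ]

/-- The count field is invariant under relabelling the particles. [folklore] -/
theorem countVec_comp_perm (ℓ : ℝ) (K : ℕ) (σ : Equiv.Perm (Fin n)) (Y : Config n) :
    countVec ℓ K (Y ∘ σ) = countVec ℓ K Y := by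
  funext B
  unfold countVec
  simp only [Function.comp_apply]
  exact Equiv.sum_comp σ (fun i => (subCell ℓ B).indicator (fun _ => (1 : ℕ)) (Y i))

/-- Any set of values of one cell's count is a measurable event of the configuration. [folklore] -/
theorem measurableSet_countVec_mem (ℓ : ℝ) (K : ℕ) (B : SubIdx K) (D : Set ℕ) :
    MeasurableSet {X : Config n | countVec ℓ K X B ∈ D} :=
  ((measurable_pi_apply B).comp (measurable_countVec (n := n) ℓ K)) MeasurableSet.of_discrete

/-- The count in a cell, as an `ℝ≥0∞`-valued sum of indicators. [folklore] -/
theorem natCast_countVec (ℓ : ℝ) (K : ℕ) (X : Config n) (B : SubIdx K) :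
    ((countVec ℓ K X B : ℕ) : ℝ≥0∞) = ∑ i : Fin n, (subCell ℓ B).indicator (fun _ => (1 : ℝ≥0∞)) (X i) := by
  unfold countVec
  push_cast
  refine Finset.sum_congr rfl fun i _ => ?_
  by_cases h : X i ∈ subCell ℓ B
  · rw [Set.indicator_of_mem h, Set.indicator_of_mem h, Nat.cast_one]
  · rw [Set.indicator_of_notMem h, Set.indicator_of_notMem h, Nat.cast_zero]

/-- **Exchangeability identity** (Bose symmetry): for cells `B' ≠ B` and any set `D` of counts,
`N · ∫_{m_B(Y) ∈ D} q_{B'}(Y) dY = ∫ N_{B'}(X) · 1_{N_B(X) ∈ D} Φ(X)² dX` — the tagged-particle pair masses of §8b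
are the size-biased cell-count laws of the symmetric state. [folklore] -/
theorem exchange_cellPairMass {L : ℝ} {K : ℕ} (hL : 0 < L) (hK : 0 < K) {Φ : Config (n + 1) → ℝ}
    (hΦm : Measurable Φ) (hsym : ∀ (σ : Equiv.Perm (Fin (n + 1))) (X : Config (n + 1)), Φ (X ∘ σ) = Φ X)
    {B B' : SubIdx K} (hBB' : B' ≠ B) (D : Set ℕ) :
    ((n + 1 : ℕ) : ℝ≥0∞) *
        ∫⁻ Y in ((fun m : SubIdx K → ℕ => m B) ∘ countVec (L / (K : ℝ)) K) ⁻¹' D, blockMass L K Φ B' Y =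
      ∫⁻ X : Config (n + 1), ((countVec (L / (K : ℝ)) K X B' : ℕ) : ℝ≥0∞) *
        {X : Config (n + 1) | countVec (L / (K : ℝ)) K X B ∈ D}.indicator
          (fun X => ENNReal.ofReal (Φ X) ^ 2) X := by
  have hKr : (0 : ℝ) < K := by exact_mod_cast hK
  have hℓ : 0 < L / (K : ℝ) := div_pos hL hKr
  set ℓ := L / (K : ℝ) with hℓdef
  set S : Set (Config (n + 1)) := {X | countVec ℓ K X B ∈ D} with hSdef
  have hS : MeasurableSet S := measurableSet_countVec_mem ℓ K B D
  have hΦ2 : Measurable fun X => ENNReal.ofReal (Φ X) ^ 2 := hΦm.ennreal_ofReal.pow_const 2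
  -- the integrand seen from particle `0`
  set G₀ : Config (n + 1) → ℝ≥0∞ := fun X =>
    (subCell ℓ B').indicator (fun _ => (1 : ℝ≥0∞)) (X 0) * S.indicator (fun X => ENNReal.ofReal (Φ X) ^ 2) X
    with hG₀def
  have hG₀m : Measurable G₀ :=
    ((measurable_const.indicator (measurableSet_subCell ℓ B')).comp (measurable_pi_apply 0)).mul
      (hΦ2.indicator hS)
  -- each particle `i` contributes `∫ G₀`
  have hterm : ∀ i : Fin (n + 1),
      ∫⁻ X, (subCell ℓ B').indicator (fun _ => (1 : ℝ≥0∞)) (X i) *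
          S.indicator (fun X => ENNReal.ofReal (Φ X) ^ 2) X = ∫⁻ X, G₀ X := by
    intro i
    have hfun : (fun X : Config (n + 1) => (subCell ℓ B').indicator (fun _ => (1 : ℝ≥0∞)) (X i) *
        S.indicator (fun X => ENNReal.ofReal (Φ X) ^ 2) X) = fun X => G₀ (X ∘ Equiv.swap 0 i) := by
      funext X
      have h0 : (X ∘ Equiv.swap 0 i) 0 = X i := by
        rw [Function.comp_apply, Equiv.swap_apply_left]
      have hmem : (X ∘ Equiv.swap 0 i ∈ S) ↔ (X ∈ S) := by
        simp only [hSdef, Set.mem_setOf_eq, countVec_comp_perm]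
      simp only [hG₀def, h0]
      congr 1
      by_cases hX : X ∈ S
      · rw [Set.indicator_of_mem hX, Set.indicator_of_mem (hmem.2 hX), hsym]
      · rw [Set.indicator_of_notMem hX, Set.indicator_of_notMem (fun h => hX (hmem.1 h))]
    rw [hfun]
    exact lintegral_comp_perm (Equiv.swap 0 i) G₀
  -- slice computation of `∫ G₀`
  have hslice : ∀ Y : Config n, ∫⁻ x, G₀ (Matrix.vecCons x Y) =
      (((fun m : SubIdx K → ℕ => m B) ∘ countVec ℓ K) ⁻¹' D).indicator (fun Y => blockMass L K Φ B' Y) Y := by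
    intro Y
    have hpt : ∀ x, G₀ (Matrix.vecCons x Y) =
        (((fun m : SubIdx K → ℕ => m B) ∘ countVec ℓ K) ⁻¹' D).indicator
          (fun Y => (subCell ℓ B').indicator (fun x => ENNReal.ofReal (Φ (Matrix.vecCons x Y)) ^ 2) x) Y := by
      intro x
      simp only [hG₀def, Matrix.cons_val_zero]
      by_cases hx : x ∈ subCell ℓ B'
      · have hxB : x ∉ subCell ℓ B := not_mem_subCell_of_ne hℓ hBB' hx
        have hcnt : countVec ℓ K (Matrix.vecCons x Y : Config (n + 1)) B = countVec ℓ K Y B := by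
          rw [countVec_vecCons, Set.indicator_of_notMem hxB, zero_add]
        have hiff : (Matrix.vecCons x Y : Config (n + 1)) ∈ S ↔
            Y ∈ ((fun m : SubIdx K → ℕ => m B) ∘ countVec ℓ K) ⁻¹' D := by
          simp only [hSdef, Set.mem_setOf_eq, hcnt, Set.mem_preimage, Function.comp_apply]
        rw [Set.indicator_of_mem hx, one_mul]
        by_cases hY : Y ∈ ((fun m : SubIdx K → ℕ => m B) ∘ countVec ℓ K) ⁻¹' D
        · rw [Set.indicator_of_mem (hiff.2 hY), Set.indicator_of_mem hY, Set.indicator_of_mem hx]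
        · rw [Set.indicator_of_notMem (fun h => hY (hiff.1 h)), Set.indicator_of_notMem hY]
      · rw [Set.indicator_of_notMem hx, zero_mul]
        by_cases hY : Y ∈ ((fun m : SubIdx K → ℕ => m B) ∘ countVec ℓ K) ⁻¹' D
        · rw [Set.indicator_of_mem hY, Set.indicator_of_notMem hx]
        · rw [Set.indicator_of_notMem hY]
    simp_rw [hpt]
    by_cases hY : Y ∈ ((fun m : SubIdx K → ℕ => m B) ∘ countVec ℓ K) ⁻¹' D
    · simp only [Set.indicator_of_mem hY]
      rw [lintegral_indicator (measurableSet_subCell ℓ B')]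
      rfl
    · simp only [Set.indicator_of_notMem hY, lintegral_zero]
  have hT : Measurable ((fun m : SubIdx K → ℕ => m B) ∘ countVec (n := n) ℓ K) :=
    (measurable_pi_apply B).comp (measurable_countVec ℓ K)
  have hfib : MeasurableSet (((fun m : SubIdx K → ℕ => m B) ∘ countVec (n := n) ℓ K) ⁻¹' D) :=
    hT MeasurableSet.of_discrete
  have hG₀int : ∫⁻ X, G₀ X = ∫⁻ Y in ((fun m : SubIdx K → ℕ => m B) ∘ countVec ℓ K) ⁻¹' D,
      blockMass L K Φ B' Y := by
    rw [lintegral_eq_lintegral_lintegral_vecCons hG₀m]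
    simp_rw [hslice]
    exact lintegral_indicator hfib _
  -- assemble
  symm
  calc ∫⁻ X, ((countVec ℓ K X B' : ℕ) : ℝ≥0∞) * S.indicator (fun X => ENNReal.ofReal (Φ X) ^ 2) X
      = ∫⁻ X, ∑ i : Fin (n + 1), (subCell ℓ B').indicator (fun _ => (1 : ℝ≥0∞)) (X i) *
          S.indicator (fun X => ENNReal.ofReal (Φ X) ^ 2) X := by
        refine lintegral_congr fun X => ?_
        rw [natCast_countVec, Finset.sum_mul]
    _ = ∑ i : Fin (n + 1), ∫⁻ X, (subCell ℓ B').indicator (fun _ => (1 : ℝ≥0∞)) (X i) *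
          S.indicator (fun X => ENNReal.ofReal (Φ X) ^ 2) X := by
        refine lintegral_finsetSum _ fun i _ => ?_
        exact ((measurable_const.indicator (measurableSet_subCell ℓ B')).comp (measurable_pi_apply i)).mul
          (hΦ2.indicator hS)
    _ = ∑ _i : Fin (n + 1), ∫⁻ X, G₀ X := Finset.sum_congr rfl fun i _ => hterm i
    _ = ((n + 1 : ℕ) : ℝ≥0∞) * ∫⁻ X, G₀ X := by
        rw [Finset.sum_const, Finset.card_univ, Fintype.card_fin, nsmul_eq_mul]
    _ = _ := by rw [hG₀int]

/-- **Tagged slice vs full count**: `∫_{m_B(Y) ∈ D} P̂(Y) dY ≤ ∫ 1_{N_B(X) ∈ D} Φ(X)² dX + ∫ q_B(Y) dY`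
(if the tagged particle is outside `Q_B`, the others' count in `B` is the full count). [folklore] -/
theorem cellSlice_le_full {L : ℝ} {K : ℕ} {Φ : Config (n + 1) → ℝ} (hΦm : Measurable Φ)
    (B : SubIdx K) (D : Set ℕ) :
    ∫⁻ Y in ((fun m : SubIdx K → ℕ => m B) ∘ countVec (L / (K : ℝ)) K) ⁻¹' D, sliceSq Φ Y ≤
      (∫⁻ X : Config (n + 1), {X : Config (n + 1) | countVec (L / (K : ℝ)) K X B ∈ D}.indicator
          (fun X => ENNReal.ofReal (Φ X) ^ 2) X) + ∫⁻ Y, blockMass L K Φ B Y := by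
  set ℓ := L / (K : ℝ) with hℓdef
  set S : Set (Config (n + 1)) := {X | countVec ℓ K X B ∈ D} with hSdef
  have hS : MeasurableSet S := measurableSet_countVec_mem ℓ K B D
  have hΦ2 : Measurable fun X => ENNReal.ofReal (Φ X) ^ 2 := hΦm.ennreal_ofReal.pow_const 2
  have hT : Measurable ((fun m : SubIdx K → ℕ => m B) ∘ countVec (n := n) ℓ K) :=
    (measurable_pi_apply B).comp (measurable_countVec ℓ K)
  have hfib : MeasurableSet (((fun m : SubIdx K → ℕ => m B) ∘ countVec (n := n) ℓ K) ⁻¹' D) :=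
    hT MeasurableSet.of_discrete
  have hF : ∀ Y : Config n, Measurable fun x => ENNReal.ofReal (Φ (Matrix.vecCons x Y)) ^ 2 := fun Y =>
    ((measurable_uncurry_slice hΦm).pow_const 2).comp (measurable_id.prodMk measurable_const)
  have hJ : Measurable fun p : Config n × Space => (Matrix.vecCons p.2 p.1 : Config (n + 1)) :=
    measurable_vecCons.comp measurable_swap
  have hx : ∀ Y : Config n, Measurable fun x : Space => (Matrix.vecCons x Y : Config (n + 1)) := fun Y =>
    measurable_vecCons.comp (measurable_id.prodMk measurable_const)
  have hmeasY : Measurable fun Y : Config n =>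
      ∫⁻ x, S.indicator (fun X => ENNReal.ofReal (Φ X) ^ 2) (Matrix.vecCons x Y : Config (n + 1)) :=
    ((hΦ2.indicator hS).comp hJ).lintegral_prod_right'
  rw [← lintegral_indicator hfib, lintegral_eq_lintegral_lintegral_vecCons (hΦ2.indicator hS),
    ← lintegral_add_left hmeasY]
  refine lintegral_mono fun Y => ?_
  by_cases hY : Y ∈ ((fun m : SubIdx K → ℕ => m B) ∘ countVec ℓ K) ⁻¹' D
  · rw [Set.indicator_of_mem hY]
    unfold sliceSq blockMass
    have hmeasx : Measurable fun x : Space =>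
        S.indicator (fun X => ENNReal.ofReal (Φ X) ^ 2) (Matrix.vecCons x Y : Config (n + 1)) :=
      (hΦ2.indicator hS).comp (hx Y)
    rw [← lintegral_indicator (measurableSet_subCell ℓ B), ← lintegral_add_left hmeasx]
    refine lintegral_mono fun x => ?_
    by_cases hxB : x ∈ subCell ℓ B
    · rw [Set.indicator_of_mem hxB]
      exact le_add_self
    · have hcnt : countVec ℓ K (Matrix.vecCons x Y : Config (n + 1)) B = countVec ℓ K Y B := by
        rw [countVec_vecCons, Set.indicator_of_notMem hxB, zero_add]
      have hmem : (Matrix.vecCons x Y : Config (n + 1)) ∈ S := by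
        simp only [hSdef, Set.mem_setOf_eq, hcnt]
        exact hY
      rw [Set.indicator_of_mem hmem]
      exact le_self_add
  · rw [Set.indicator_of_notMem hY]
    exact bot_le

/-- Fibre sums over a set of values: `Σ'_{j} 1_D(j) ∫_{T = j} g = ∫_{T ∈ D} g`. [folklore] -/
theorem tsum_indicator_fibre {β : Type*} [MeasurableSpace β] {σ : Type*} [MeasurableSpace σ]
    [MeasurableSingletonClass σ] [Countable σ] (ν : Measure β) {T : β → σ} (hT : Measurable T)
    (g : β → ℝ≥0∞) (D : Set σ) :
    ∑' j, D.indicator (fun j => ∫⁻ b in T ⁻¹' {j}, g b ∂ν) j = ∫⁻ b in T ⁻¹' D, g b ∂ν := by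
  rw [lintegral_eq_tsum_fibre (ν.restrict (T ⁻¹' D)) hT g]
  refine tsum_congr fun j => ?_
  rw [Measure.restrict_restrict (hT (measurableSet_singleton j))]
  by_cases hj : j ∈ D
  · have hsub : T ⁻¹' ({j} : Set σ) ⊆ T ⁻¹' D := fun b hb => by
      simp only [Set.mem_preimage, Set.mem_singleton_iff] at hb ⊢
      rw [hb]; exact hj
    rw [Set.indicator_of_mem hj, Set.inter_eq_left.2 hsub]
  · have hempty : T ⁻¹' ({j} : Set σ) ∩ T ⁻¹' D = ∅ := by
      ext b
      simp only [Set.mem_inter_iff, Set.mem_preimage, Set.mem_singleton_iff, Set.mem_empty_iff_false,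
        iff_false, not_and]
      intro hb; rw [hb]; exact hj
    rw [Set.indicator_of_notMem hj, hempty, Measure.restrict_empty, lintegral_zero_measure]

/-- `w_K² = K⁻³`. [folklore] -/
theorem blockWeight_sq {K : ℕ} (hK : 0 < K) : blockWeight K ^ 2 = ENNReal.ofReal (((K : ℝ) ^ 3)⁻¹) := by
  have h2 : ((Real.sqrt (1 / (K : ℝ))) ^ 3) ^ 2 = ((K : ℝ) ^ 3)⁻¹ := by
    rw [← pow_mul, show 3 * 2 = 2 * 3 by norm_num, pow_mul, Real.sq_sqrt (by positivity), one_div, inv_pow]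
  rw [blockWeight, ← ENNReal.ofReal_pow (by positivity), h2]

/-- **Count variance at the block scale** `Σ_B K⁻³ ∫ (N_B(X)/λ − 1)² Φ(X)² dX` (`λ = N/K³`): the mean-square
relative fluctuation of the FULL cell counts.  NEW OBJECT of §10 (a two-body functional: density–density
correlations at scale `L/K`). [folklore] -/
noncomputable def countVariance (L : ℝ) (K : ℕ) (Φ : Config (n + 1) → ℝ) : ℝ≥0∞ :=
  ∑ B : SubIdx K, blockWeight K ^ 2 *
    ∫⁻ X : Config (n + 1), ENNReal.ofReal ((((countVec (L / (K : ℝ)) K X B : ℕ) : ℝ) /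
      (((n + 1 : ℕ) : ℝ) / (K : ℝ) ^ 3) - 1) ^ 2) * ENNReal.ofReal (Φ X) ^ 2

/-- The designated neighbour index along axis `0`: `t + 1` if it exists, else `t − 1`. [folklore] -/
def nbFin {K : ℕ} (t : Fin K) : Fin K :=
  if h : (t : ℕ) + 1 < K then ⟨(t : ℕ) + 1, h⟩ else ⟨(t : ℕ) - 1, lt_of_le_of_lt (Nat.sub_le _ _) t.isLt⟩

/-- The designated neighbour cell `nb B` of `B` (shift along axis `0`). [folklore] -/
def nb {K : ℕ} (B : SubIdx K) : SubIdx K := Function.update B 0 (nbFin (B 0))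

/-- `nb B` is an `ℓ^∞`-neighbour of `B` once `K ≥ 2`. [folklore] -/
theorem nb_mem_nbrs {K : ℕ} (hK : 2 ≤ K) (B : SubIdx K) : nb B ∈ nbrs B := by
  refine ⟨fun h => ?_, fun i => ?_⟩
  · have h0 := congrFun h 0
    rw [nb, Function.update_self] at h0
    unfold nbFin at h0
    split_ifs at h0 with hlt
    · have := congrArg Fin.val h0; simp at this
    · have := congrArg Fin.val h0
      simp only at this
      have ht : (B 0 : ℕ) < K := (B 0).isLt
      omega
  · by_cases hi : i = 0
    · subst hi
      rw [nb, Function.update_self]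
      unfold nbFin
      split_ifs with hlt
      · simp only
        constructor <;> omega
      · simp only
        constructor <;> omega
    · rw [nb, Function.update_of_ne hi]
      constructor <;> omega

/-- Each cell is the designated neighbour of at most two cells: `Σ_B V(nb B) ≤ 2 Σ_B V(B)`. [folklore] -/
theorem sum_nb_le {K : ℕ} (V : SubIdx K → ℝ≥0∞) : ∑ B : SubIdx K, V (nb B) ≤ 2 * ∑ B : SubIdx K, V B := by
  classical
  set P : SubIdx K → Prop := fun B => (B 0 : ℕ) + 1 < K with hP
  have hsplit := (Finset.sum_filter_add_sum_filter_not (Finset.univ : Finset (SubIdx K)) P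
    (fun B => V (nb B))).symm
  rw [hsplit, two_mul]
  have hinj₁ : Set.InjOn (nb (K := K)) ↑(Finset.univ.filter P) := by
    intro B₁ h₁ B₂ h₂ h
    simp only [Finset.coe_filter, Finset.mem_univ, true_and, Set.mem_setOf_eq, hP] at h₁ h₂
    funext i
    by_cases hi : i = 0
    · subst hi
      have h0 := congrFun h 0
      rw [nb, nb, Function.update_self, Function.update_self] at h0
      unfold nbFin at h0
      rw [dif_pos h₁, dif_pos h₂] at h0
      have := congrArg Fin.val h0
      simp only at this
      exact Fin.ext (by omega)
    · have := congrFun h i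
      rwa [nb, nb, Function.update_of_ne hi, Function.update_of_ne hi] at this
  have hinj₂ : Set.InjOn (nb (K := K)) ↑(Finset.univ.filter fun B => ¬ P B) := by
    intro B₁ h₁ B₂ h₂ h
    simp only [Finset.coe_filter, Finset.mem_univ, true_and, Set.mem_setOf_eq, hP] at h₁ h₂
    funext i
    by_cases hi : i = 0
    · subst hi
      have h0 := congrFun h 0
      rw [nb, nb, Function.update_self, Function.update_self] at h0
      unfold nbFin at h0
      rw [dif_neg h₁, dif_neg h₂] at h0
      have := congrArg Fin.val h0
      simp only at this
      have ht₁ : (B₁ 0 : ℕ) < K := (B₁ 0).isLt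
      have ht₂ : (B₂ 0 : ℕ) < K := (B₂ 0).isLt
      exact Fin.ext (by omega)
    · have := congrFun h i
      rwa [nb, nb, Function.update_of_ne hi, Function.update_of_ne hi] at this
  refine add_le_add ?_ ?_
  · rw [← Finset.sum_image hinj₁]
    exact Finset.sum_le_sum_of_subset (Finset.subset_univ _)
  · rw [← Finset.sum_image hinj₂]
    exact Finset.sum_le_sum_of_subset (Finset.subset_univ _)

/-- **Markov + Chebyshev, pointwise**: with `λ > 0`, `a ≤ b`,
`a ≤ (2N'/λ)·a + 4(N'/λ − 1)²·b` (first term when `N' > λ/2`, second when `N' ≤ λ/2`). [folklore] -/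
theorem le_markov_add_chebyshev {lam : ℝ} (hlam : 0 < lam) (N' : ℕ) {a b : ℝ≥0∞} (hab : a ≤ b) :
    a ≤ ENNReal.ofReal (2 / lam * (N' : ℝ)) * a + 4 * ENNReal.ofReal (((N' : ℝ) / lam - 1) ^ 2) * b := by
  by_cases h : (N' : ℝ) ≤ lam / 2
  · have hq : (1 / 4 : ℝ) ≤ ((N' : ℝ) / lam - 1) ^ 2 := by
      have h1 : (N' : ℝ) / lam ≤ 1 / 2 := by
        rw [div_le_iff₀ hlam]; linarith
      have h2 : (1 / 2 : ℝ) ≤ 1 - (N' : ℝ) / lam := by linarith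
      have h0 : (0 : ℝ) ≤ 1 / 2 := by norm_num
      calc (1 / 4 : ℝ) = (1 / 2) ^ 2 := by norm_num
        _ ≤ (1 - (N' : ℝ) / lam) ^ 2 := pow_le_pow_left₀ h0 h2 2
        _ = ((N' : ℝ) / lam - 1) ^ 2 := by ring
    have hone : (1 : ℝ≥0∞) ≤ 4 * ENNReal.ofReal (((N' : ℝ) / lam - 1) ^ 2) :=
      calc (1 : ℝ≥0∞) = 4 * ENNReal.ofReal (1 / 4) := by
            rw [ENNReal.ofReal_div_of_pos (by norm_num : (0:ℝ) < 4), ENNReal.ofReal_one,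
              ENNReal.ofReal_ofNat, ENNReal.mul_div_cancel (by norm_num) ENNReal.ofNat_ne_top]
        _ ≤ 4 * ENNReal.ofReal (((N' : ℝ) / lam - 1) ^ 2) := by
            gcongr
    calc a ≤ b := hab
      _ = 1 * b := (one_mul b).symm
      _ ≤ 4 * ENNReal.ofReal (((N' : ℝ) / lam - 1) ^ 2) * b := mul_le_mul' hone le_rfl
      _ ≤ _ := le_add_self
  · rw [not_le] at h
    have hone : (1 : ℝ≥0∞) ≤ ENNReal.ofReal (2 / lam * (N' : ℝ)) := by
      rw [ENNReal.one_le_ofReal, div_mul_eq_mul_div, le_div_iff₀ hlam]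
      linarith
    calc a = 1 * a := (one_mul a).symm
      _ ≤ ENNReal.ofReal (2 / lam * (N' : ℝ)) * a := mul_le_mul' hone le_rfl
      _ ≤ _ := le_self_add

/-- Measurability of the `ℝ≥0∞`-valued cell count. [folklore] -/
theorem measurable_natCast_ennreal_countVec {ℓ : ℝ} {K : ℕ} (B : SubIdx K) :
    Measurable fun X : Config n => ((countVec ℓ K X B : ℕ) : ℝ≥0∞) :=
  (measurable_of_countable fun k : ℕ => (k : ℝ≥0∞)).comp
    ((measurable_pi_apply B).comp (measurable_countVec ℓ K))

/-- Measurability of the variance integrand `(N_B/λ − 1)² Φ²`. [folklore] -/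
theorem measurable_varTerm {ℓ : ℝ} {K : ℕ} (B : SubIdx K) (lam : ℝ) {Φ : Config n → ℝ} (hΦm : Measurable Φ) :
    Measurable fun X : Config n =>
      ENNReal.ofReal ((((countVec ℓ K X B : ℕ) : ℝ) / lam - 1) ^ 2) * ENNReal.ofReal (Φ X) ^ 2 :=
  ((measurable_of_countable fun k : ℕ => ENNReal.ofReal ((((k : ℕ) : ℝ) / lam - 1) ^ 2)).comp
    ((measurable_pi_apply B).comp (measurable_countVec ℓ K))).mul (hΦm.ennreal_ofReal.pow_const 2)

end Summit.AtomisticToContinuum.BoseEinsteinCondensation.Theorems.BoxCountShadow
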